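import Mathlib
import HarnessLib
import HarnessLib.Audit
import Summits.SmoothPoincare4.Statement
import Literature.Topology.FourManifolds.HomotopySpheres
import Literature.Topology.FourManifolds.Morse
import Literature.Topology.FourManifolds.HomotopyS4CompactProofs
import Literature.Topology.FourManifolds.HomotopyS4OrientableProofs
import HarnessLib.Audit.Status.Attr

/-!
Route: NoOneHandles

Route NoOneHandles (SmoothPoincare4, positive side; technique class: Kirby calculus, 1-handle-free
handle decompositions + weak Generalised Property R). It suffices to show X = C1 ∧ C2: (C1, item
`NoohNoOneHandles`) every homotopy 4-sphere admits a Morse function without index-1 critical points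
(a handle decomposition without 1-handles: it is geometrically simply connected), and (C2, item
`NoohGscStandard`) every homotopy 4-sphere carrying such a function is diffeomorphic to S⁴. X ⇔ SPC4
(the height function on the round S⁴ gives both conjuncts), so no slack is lost; the content is the
split: C2 is the weak Generalised Property R conjecture with a PROVED base case (one 2-handle =
Gabai's Property R) and a slide/Hopf-pair calculus that keeps standardising R-link families, C1 is
Kirby Problem 4.18 restricted to homotopy spheres.
Lean: `(∀ S : Literature.Topology.FourManifolds.HomotopySphere 4, ∃ f : S.carrier → ℝ,
Literature.Topology.FourManifolds.IsMorse (𝓡 4) f ∧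
Literature.Topology.FourManifolds.criticalSetOfIndex (𝓡 4) f 1 = ∅) ∧ (∀ (S :
Literature.Topology.FourManifolds.HomotopySphere 4) (f : S.carrier → ℝ),
Literature.Topology.FourManifolds.IsMorse (𝓡 4) f →
Literature.Topology.FourManifolds.criticalSetOfIndex (𝓡 4) f 1 = ∅ → Nonempty (S.carrier ≃ₘ⟮𝓡 4, 𝓡
4⟯ Metric.sphere (0 : EuclideanSpace ℝ (Fin 5)) 1))`
Deciding theorem (D-0027 §2.1; route repair 2026-08-15): `theorem closes (h₁ : NoohNoOneHandles) (h₂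
: NoohGscStandard) : SmoothPoincare4`, PROVED sorry-free with axioms propext / Classical.choice /
Quot.sound — C1 supplies the Morse function, C2 the diffeomorphism, and the bare smooth `M ≃ₕ S⁴` of
the Statement is packaged as a `Literature.Topology.FourManifolds.HomotopySphere 4` with the proved
tree facts `Literature.Topology.FourManifolds.compactSpace_of_homotopyEquiv_sphere_four_holds`
(Hatcher Prop. 3.29) and
`Literature.Topology.FourManifolds.isOrientable_of_homotopyEquiv_sphere_four_holds` (Lee Thm.
15.43), used inside the proof, not assumed. Target item `NoohThesis` = C1 ∧ C2; `Assembly` = X →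
SmoothPoincare4 (bookkeeping).

Rationale: WHY THIS LINE. Handle calculus is where all positive evidence on SPC4 lives: the Cappell–Shaneson
family, Gompf's H(n,k) and many Gluck twists were standardised by 1-handle-free / cancelling
diagrams [Akbulut2010, Gompf2010, AkbulutKirby1985; MeierZupan2022 Thm 1.1: no 1-handles + two
2-handles, one along a generalised square knot ⇒ S⁴]. Mechanism behind C2: with no 1-handles, χ = 2
and H₂ = 0 force n 2-handles and n 3-handles; the 2-handles are attached along a framed n-component
link L ⊂ S³ whose surgery is #ⁿ(S¹×S²) [LaudenbachPoenaru1972 = tree fact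
`exists_diffeomorph_comp_incl_eq`; Trace1982]; if L becomes the 0-framed unlink after slides and
Hopf pairs, Σ ≅ S⁴, and by Cerf theory C2 is exactly the WEAK Generalised Property R conjecture
[GompfScharlemannThompson2010 Prop 9.2; MeierZupan2022 p.4]. n = 1 is Gabai's Property R [Gabai1987]
(tree fact `isUnknot_of_isIntegralSurgery_zero`): a proved base case. Imports: 3-manifold topology
(Property R, sutured manifolds, thin position), combinatorial group theory (Andrews–Curtis, dual
3-handle-free picture); no analytic/probabilistic reformulation — the combinatorial-topology
baseline of the sub-problem. Negatives index: empty at filing and at repair.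
RANKED CRUXES. #2 NoohGscStandard (C2) — a homotopy 4-sphere with a Morse function without index-1
critical points is ≅ S⁴ (why it might fail: = weak GPRC; only n ≤ 1 two-handles and the square-knot
n = 2 families are known; one R-link that is not slide+Hopf-pair trivial gives a geometrically
simply connected exotic S⁴; GompfScharlemannThompson2010, MeierZupan2022, Gabai1987). #3
NoohNoOneHandles (C1) — every homotopy 4-sphere has such a Morse function (why it might fail: Kirby
4.18 is open even for homotopy spheres; 1↔3-handle trading needs smoothly embedded 2-discs, only TOP
available; Kirby1997, Yasui2019, GompfStipsicz1999). #0 NoohThesis = C1 ∧ C2 (target); #1 Assembly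
(bookkeeping — the deciding theorem `closes` is proved over #2, #3).
KILL CRITERIA. C1 or C2 refuted ⇒ SPC4 itself is refuted (each is a consequence of SPC4): the route
closes with the problem (`close --reason refuted:<Decl>`). Soft kill: if C2 stays mechanism-free
beyond the known families for a tenure round while no new R-link family is standardised, park the
route (dormant) below PIC / Stabilisation, do not close it.
NOT DECOMPOSED YET. Property 2R and the STABLE GPRC as sufficient children of C2 (need a
`FramedLink` disjoint-union / stabilisation API); the dual line "no 3-handles + Andrews–Curtis
triviality of the induced balanced presentation ⇒ S⁴" (needs the presentation-of-a-handlebody map);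
the trisection-genus reformulation. Repair 2026-08-15: the unstable GPRC in link form (former
support item stmt-SmoothPoincare4-0379, expected FALSE for n ≥ 2 by GST2010 §7, catalogued as
Literature.Barriers.SmoothPoincare4.PropertyTwoRBarrier / `not_generalizedPropertyR_of_gst`) was
DROPPED — never load-bearing, and its Kirby-move vocabulary pulled four unproved smoothness facts
(`isSmoothEmbedding_sphereInclusion`, `isSmoothEmbedding_comp_reflectLast`,
`isSmoothEmbedding_reflectLast_comp`, `Knot.TubularNbhd.isSmoothEmbedding_pushOff`) into the
dependency cone; re-file it as a stand-alone refuter target once those are proved. The shared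
reductions stmt-SmoothPoincare4-0374/0441 left THIS route (their sibling routes keep them): the
packaging facts are proved and now sit inside `closes`.
CHEAPEST FALSIFIER. One R-link (n ≥ 2 components, 0-surgery ≅ #ⁿ S¹×S²) whose homotopy sphere X_L is
shown NOT diffeomorphic to S⁴ kills C2 and SPC4 at once; no invariant is known to detect this at b₂
= 0, so the check refuters can actually run is the lookup: is any 1-handle-free homotopy 4-sphere in
print claimed exotic or left unstandardised with evidence (GST2010 L_n family, Property-2R
candidates, OliveiraSmith2026 = arXiv:2603.23717, LidmanOliveiraSmithZupan2026 = arXiv:2603.05664)?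
2026-08-14/15 searches: none claimed exotic; the named families are standardised or open.

Novelty: NOVELTY (retriage planner 2026-08-14, refreshed at the 2026-08-15 route repair; searched: `lit
search --hybrid "geometrically simply connected homotopy 4-sphere without 1-handles Property R"`,
`lit search "Generalized Property R homotopy 4-sphere no 1-handles" --year-from 2010 --source all`,
`lit frontier SmoothPoincare4 --since 2024`, `lit read` of the hits below).
Nearest prior art actually found:
- [GompfScharlemannThompson2010] = arXiv:1103.1601, p.27 Prop 9.2: "The Weak Generalized Property R
Conjecture is equivalent to the Smooth 4-Dimensional Poincaré Conjecture for homotopy spheres that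
admit handle decompositions without 1-handles" — this IS conjunct C2 (`NoohGscStandard`); §7: the
unstable GPRC (former support item `NoohGprc`, stmt-0379, dropped from the route 2026-08-15) is
"probably false" (L_{n,1} vs Andrews–Curtis).
- [MeierZupan2022] = arXiv:1904.08527 (doi:10.4310/jdg/1668186788), pp.2–3: geometrically simply
connected homotopy 4-spheres with two 2-handles from generalised square knots; large subfamilies
standardised; "the consensus appears to be that neither [GPRC nor Stable GPRC] is likely to be
true".
- Miller–Zupan, arXiv:2005.11243, p.3: a homotopy 4-sphere with a 1-handle-free decomposition gives
an R-link; R-links ↔ handle-ribbon knots.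
- [OliveiraSmith2026] = arXiv:2603.23717, p.10 Conj. 3.1 and the Dunfield–Gong sphere standardised
by R-link slides; [LidmanOliveiraSmithZupan2026] = arXiv:2603.05664 (a homological GPRC is false);
[DiaoPanYan2026] = arX  [refs: 10.4310/jdg/1668186788, 1103.1601, 1904.08527, 2005.11243, 2603.23717, 2603.05664, 2604.17737, 0802.3372, 1807.11453, doi:10.4310/jdg/1668186788, GompfScharlemannThompson2010, MeierZupan2022, OliveiraSmith2026, LidmanOliveiraSmithZupan2026, DiaoPanYan2026, Yasui2008, Yasui2019, Gabai1987, LaudenbachPoenaru1972, Trace1982]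

Barriers (technique_class: Kirby calculus; no 1-handles + weak Generalised Property R): BARRIERS (catalogue `Literature/Barriers/SmoothPoincare4/`, read 2026-08-14, refreshed 2026-08-15;
technique_class: Kirby calculus; no 1-handles + weak Generalised Property R):
- Literature.Barriers.SmoothPoincare4.StrictPropertyTwoRBarrier (GST2010 §7 over the PRINTED
strict-slide Property 2R / Generalised Property R, `not_strictGeneralizedPropertyR_of_gst`,
conditional on the open `AKPresentationsACNontrivial`; the deprecated permissive entry was merged
into it 2026-08-15) — does NOT hit any filed statement: the route no longer asserts a GPRC at all
(the permissive link-form support item stmt-0379 `NoohGprc` was DROPPED at the 2026-08-15 repair —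
never load-bearing, its vocabulary carried unproved smoothness facts into the cone — and by the
entry's caveat (c) it was not even reached by the Andrews–Curtis invariant), and the load-bearing
crux C2 (`NoohGscStandard`) is, by GST2010 Prop 9.2, the WEAK GPRC with cancelling Hopf pairs, which
"destroys the Andrews-Curtis invariant" — the entry's own caveat (e) says nothing in it bears on C2.
It WOULD apply to a future child of C2 stating the printed or the unlink-stabilised GPRC (§9: a
distant unlink preserves the AC class): such a child must allow Hopf pairs / 1-handle stabilisation.
- Literature.Barriers.SmoothPoincare4.HCobordismBarrierFour (Donaldson: h-cobordism ⇒ diffeomorphism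
fails in dim 4) — does NOT apply: the line never passes through an h-cobordism; Σ ≅ S⁴ is to be
built handle-by-handle (link slides + Laudenbach–Poen

History (route lifecycle, newest last):
- 2026-08-15T16:21:01Z · rev 3: dropped NoohGprc, Spc4ReductionHomotopySphere, Spc4ReductionHomotopySphereV2 — route-repair 2026-08-15 (planner-rbadge-…-g4-0): GLUE PROVED — `closes (h₁ : NoohNoOneHandles) (h₂ : NoohGscStandard) : SmoothPoincare4`, sorry-free, axioms pro (planner-rbadge-SmoothPoincare4-NoOneHandles-0910ba2f-g4-0)
- 2026-08-21T23:02:42Z · DORMANT — reconciler: no traction for 5 d (last activity item-evidence-added at 2026-08-16T22:22:36Z); parked, not closed — `ledger route dormant route-SmoothPoincare4-No (operator:999:1429813)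
- 2026-08-30T03:42:08Z · REACTIVATED — reconciler: reactivated — activity statement-attached at 2026-08-30T02:29:15Z after parking at 2026-08-21T23:02:42Z (operator:999:37360)

sub-problem: SmoothPoincare4 · status: open · opened planner-SmoothPoincare4-Survey-0 2026-08-13T06:11:41Z · rev 4 · ledger route-SmoothPoincare4-NoOneHandles
GENERATED by the gate from the ledger (D-0016/17). Provers cite these decls: `theorem foo : Summit.SmoothPoincare4.SmoothPoincare4.Theses.NoOneHandles.<Decl> := …` in Summits/SmoothPoincare4/SmoothPoincare4/Theorems/<Name>.lean.
-/

namespace Summit.SmoothPoincare4.SmoothPoincare4.Theses.NoOneHandles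

open scoped BigOperators Topology Manifold Classical MeasureTheory ProbabilityTheory Matrix InnerProductSpace ComplexConjugate ContinuousMap ContDiff
open Filter Set Function TopologicalSpace MeasureTheory

attribute [summit_statement] _root_.SmoothPoincare4

open Literature.SPC4

/-- item stmt-SmoothPoincare4-0375 · target · rank 0 · open · by planner
why it might fail: X = C1 ∧ C2 ⟺ SPC4 (height function on S⁴ gives both; converse = the proved `closes`): it fails iff an exotic S⁴ exists, and live candidates (Gluck twists of non-ribbon 2-knots, zero-surgery-homeomorphism spheres) are neither standardised nor obstructed by any invariant at b₂ = 0.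
sources: GompfScharlemannThompson2010, FreedmanGompfMorrisonWalker2010, ManolescuPiccirillo2023
(C1) every homotopy 4-sphere carries a Morse function with no index-1 critical points
(`Literature.Topology.FourManifolds.IsMorse`, `Literature.Topology.FourManifolds.criticalSetOfIndex
… 1 = ∅`); (C2) any homotopy 4-sphere carrying such a function is diffeomorphic to S⁴. Sources:
Kirby1997 4.18, 1.82; Gabai1987; LaudenbachPoenaru1972; Trace1982; GompfScharlemannThompson2010.
opens: `open scoped Manifold ContDiff`, `open ContinuousMap`; imports:
Summits.SmoothPoincare4.Statement +
Literature.Topology.FourManifolds.{HomotopySpheres,KirbyMoves,SliceRibbon,LeeRasmussen,Morse,ConnectedSum,Cobordism,GluckTwist,SurgeryGluck,CappellShaneson}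
+ Literature.Geometry.Lorentzian.LeviCivita. -/
@[route_item "route-SmoothPoincare4-NoOneHandles"]
def NoohThesis : Prop :=
  (∀ S : Literature.Topology.FourManifolds.HomotopySphere 4, ∃ f : S.carrier → ℝ, Literature.Topology.FourManifolds.IsMorse (𝓡 4) f ∧ Literature.Topology.FourManifolds.criticalSetOfIndex (𝓡 4) f 1 = ∅) ∧ (∀ (S : Literature.Topology.FourManifolds.HomotopySphere 4) (f : S.carrier → ℝ), Literature.Topology.FourManifolds.IsMorse (𝓡 4) f → Literature.Topology.FourManifolds.criticalSetOfIndex (𝓡 4) f 1 = ∅ → Nonempty (S.carrier ≃ₘ⟮𝓡 4, 𝓡 4⟯ Metric.sphere (0 : EuclideanSpace ℝ (Fin 5)) 1))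

/-- item stmt-SmoothPoincare4-0377 · crux · rank 2 · open · by planner
why it might fail: C2 ⟺ Weak Generalised Property R (GST2010 Prop 9.2) = SPC4 restricted to 1-handle-free homotopy spheres; only n ≤ 1 two-handles is known (Gabai). One R-link that is not slide+Hopf-pair trivial (GST's L_{n,1}, generalised-square-knot R-links beyond Meier–Zupan's cases) would be a g.s.c. exotic S⁴.
sources: GompfScharlemannThompson2010, MeierZupan2022, Gabai1987, OliveiraSmith2026, Literature.Topology.FourManifolds.isUnknot_of_isIntegralSurgery_zero
No 1-handles ⇒ n 2-handles + n 3-handles (χ = 2, H₂ = 0); the framed attaching link L ⊂ S³ surgers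
to #ⁿ S¹×S²; if L is (stably) handle-slide equivalent to the 0-framed unlink then Σ ≅ S⁴ by
Laudenbach–Poenaru (Literature `exists_diffeomorph_comp_incl_eq`). n = 1: Gabai's Property R
(Literature `isUnknot_of_isIntegralSurgery_zero`) ⇒ standard. n = 2 = Property 2R territory.
Sources: Gabai1987; LaudenbachPoenaru1972; Trace1982; GompfScharlemannThompson2010; Kirby1997 1.82. -/
@[route_item "route-SmoothPoincare4-NoOneHandles", crux]
def NoohGscStandard : Prop :=
  ∀ (S : Literature.Topology.FourManifolds.HomotopySphere 4) (f : S.carrier → ℝ), Literature.Topology.FourManifolds.IsMorse (𝓡 4) f → Literature.Topology.FourManifolds.criticalSetOfIndex (𝓡 4) f 1 = ∅ → Nonempty (S.carrier ≃ₘ⟮𝓡 4, 𝓡 4⟯ Metric.sphere (0 : EuclideanSpace ℝ (Fin 5)) 1)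

/-- item stmt-SmoothPoincare4-0378 · crux · rank 3 · open · by planner
why it might fail: Kirby 4.18 is open even for homotopy spheres: 1↔3-handle trading needs smoothly embedded 2-discs (TOP only, Freedman). An exotic S⁴ whose every decomposition needs 1-handles refutes it; the only known obstructions to 'no 1-handles' (Yasui2019 Thm 1.4, stable cohomotopy SW) need b₂⁺ > 1 — blind here.
sources: Kirby1997, Yasui2019, Yasui2008, GompfStipsicz1999
Kirby Problem 4.18 (for all closed simply connected 4-manifolds) specialised to homotopy spheres. No
obstruction known; 1-handle ↔ 3-handle trading needs an embedded-disc input. Sources: Kirby1997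
4.18; GompfStipsicz1999 §5.1. -/
@[route_item "route-SmoothPoincare4-NoOneHandles", crux]
def NoohNoOneHandles : Prop :=
  ∀ S : Literature.Topology.FourManifolds.HomotopySphere 4, ∃ f : S.carrier → ℝ, Literature.Topology.FourManifolds.IsMorse (𝓡 4) f ∧ Literature.Topology.FourManifolds.criticalSetOfIndex (𝓡 4) f 1 = ∅

/-- item stmt-SmoothPoincare4-0376 · assembly · rank 1 · open · by planner
Immediate from C1, C2 and the shared reduction item (compactness + orientability of a manifold ≃ₕ
S⁴). -/
@[route_item "route-SmoothPoincare4-NoOneHandles"]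
def Assembly : Prop :=
  ((∀ S : Literature.Topology.FourManifolds.HomotopySphere 4, ∃ f : S.carrier → ℝ, Literature.Topology.FourManifolds.IsMorse (𝓡 4) f ∧ Literature.Topology.FourManifolds.criticalSetOfIndex (𝓡 4) f 1 = ∅) ∧ (∀ (S : Literature.Topology.FourManifolds.HomotopySphere 4) (f : S.carrier → ℝ), Literature.Topology.FourManifolds.IsMorse (𝓡 4) f → Literature.Topology.FourManifolds.criticalSetOfIndex (𝓡 4) f 1 = ∅ → Nonempty (S.carrier ≃ₘ⟮𝓡 4, 𝓡 4⟯ Metric.sphere (0 : EuclideanSpace ℝ (Fin 5)) 1))) → SmoothPoincare4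

/-! D-0027 §2.1 — DECIDING THEOREM (planner-authored via `route open/edit --closes-file`; by planner-rbadge-SmoothPoincare4-NoOneHandles-0910ba2f-g4-0 2026-08-15T16:21:01Z):
its hypotheses are this route's items and its conclusion the sub-problem Statement (glue_lint), and it elaborates with this file. -/

@[closes "route-SmoothPoincare4-NoOneHandles"] theorem closes (h₁ : NoohNoOneHandles) (h₂ : NoohGscStandard) : _root_.SmoothPoincare4 := by
  -- The two cruxes give every `HomotopySphere 4` diffeomorphic to the round `S⁴` (C1 supplies a
  -- Morse function without index-1 critical points, C2 standardises the sphere carrying it); the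
  -- Statement quantifies over bare smooth `M ≃ₕ S⁴`, packaged as a `HomotopySphere 4` with the
  -- PROVED tree facts (used inside the proof, not assumed): compactness
  -- (`compactSpace_of_homotopyEquiv_sphere_four_holds`, Hatcher Prop. 3.29) and orientability
  -- (`isOrientable_of_homotopyEquiv_sphere_four_holds`, Lee Thm. 15.43).
  intro M _ _ _ _ _ e
  haveI : CompactSpace M :=
    Literature.Topology.FourManifolds.compactSpace_of_homotopyEquiv_sphere_four_holds M e
  obtain ⟨o⟩ :=
    Literature.Topology.FourManifolds.isOrientable_of_homotopyEquiv_sphere_four_holds M e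
  obtain ⟨f, hf, h1⟩ := h₁ ⟨M, o, ⟨e⟩⟩
  exact h₂ ⟨M, o, ⟨e⟩⟩ f hf h1

end Summit.SmoothPoincare4.SmoothPoincare4.Theses.NoOneHandles
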